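import Summits.ABC.IUTFork.Cor312RamifiedEIsmBarrier
import Summits.ABC.IUTFork.Repair.CandMochizuki7RamE
import HarnessLib

/-!
# [IUTchIII] Cor. 3.12 — the ramified bed RAM_e(p, m) under ISOMETRIC readings of Ism (general ramification index `e`):
# every indeterminacy fixes every polydisc; (Ind1),(Ind2) ELIMINABLE; the typed Corollary and the licence FAIL at every depth `m ≥ 1`

Record-only file (D-0012; MODEL DATA `VLe`/`latE`/`isoKE`/`ValMonoE`/`PreservesBoxesE` — bookkeeping predicates with parameters, no `Prop` fact —,
then proofs; nothing asserted about print) of the abc-iut cell, IUT REPAIR BRANCH (rung LADDER-ABC:A2.RP), seat abc-iut-rp-m1 (gen 5; class (ii)).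
TAKES NO SIDE on [IUTchIII] Cor. 3.12 or on any author. General-`e` form of the seat's gen-3 `Repair/CandMochizuki7RamIsometric` (`e = 2`), over
gen 4's `Cor312RamifiedEIsmBarrier` (settings RAM_{e;G₁,G₂}(p, m) = `ramSettingWith p e G₁ G₂ h₁ h₂ m` for an ARBITRARY reading `1 ∈ G₁` of the
strip-automorphisms and `1 ∈ G₂` of Ism; `K = ℚ_p(π)`, `π^e = p`, polydiscs `box k` ↔ `π^k·𝒪_L`, `μ(box k) = −(k/e)·log p`, `l⋇ = 2`, `q = π^m`).
THE ISOMETRIC READINGS: `isoKE p e` := the `ℚ`-linear automorphisms of `ℚ^e = ⊕ ℚ·π^i` with `x ∈ π^k𝒪_K ⟺ g x ∈ π^k𝒪_K` for EVERY `k` (`latE k`)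
— the VALUATION-ISOMETRIES of `K`, the most generous reading of print's Ism preserving the `π`-adic valuation ([IUTchII] Ex. 1.8 (iv): Ism ⊇
`𝒪_K^×`-multiplications, Galois — all valuation-isometries; NOT the transpositions / reversal / transvections of the Dupuy–Hilado reading `GL(I)`
[cite: DupuyHilado2025, §4.9] that gen 3/4/5 use as movers). KERNEL FACTS, for EVERY reading `1 ∈ G₁, G₂ ⊆ isoKE`, every `p`, `e ≥ 1`, `m`:
* `vle_ent_isoKE` — the matrix of a valuation-isometry is lower-triangular by valuation: `e·v_p(g_{ab}) ≥ b − a`;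
* `preservesBoxesE_of_mem_closureIso` — **every element of ⟨(Ind1)∪(Ind2)⟩ maps every polydisc `box k` ONTO itself** (Kronecker products of
  valuation-isometries and factor permutations are valuation-monotone); `image_piEltE_eq_piEltE_imp` — it carries `π^k` to `π^{k'}` only if `k = k'`;
* `thetaHullWith_eq_thetaBox_of_isometricE` — **`ⁿ˒°𝒰_j = box(m·j²)`: (Ind1),(Ind2) ELIMINABLE from `−|log(Θ)|`** (typed content of the (SSInd)
  [Rpt2018] p. 9 l. 19–21 vs (†ΘCR) p. 16 l. 58–66 exchange for these readings; no side); `negLogThetaWith_isometricE` `= −(5m/(2e))·log p`;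
* **`not_statementWith_of_isometricE` — the typed Corollary 3.12 FAILS at EVERY depth `m ≥ 1`, EVERY index `e`**; **`not_licenceWith_of_isometricE`**
  — the hull inclusion (xi-f) FAILS (label 2: `box m ⊄ box 4m`).
READING (neutral): what the RAM_e family delivers in gen 4's windows (typed Corollary for `m ≤ e − 1`, residual for `e > 4m`) is borne by NON-isometric
lattice automorphisms; under every valuation-isometric reading the ramified bed of any index is a countermodel at every depth — and (sequel
`Repair/CandMochizuki7RamEIsoPins`) one on which the Corollary's own three pins ARE satisfiable. Interface-level toy over `toyIndex`; NOT a model of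
initial Θ-data; nothing here bears on which reading of Thm. 3.11 is right. [claim: Mochizuki2012, status: disputed] [cite: ScholzeStix2018, §2.2 pp. 9–10]
-/

noncomputable section
noncomputable section
noncomputable section

namespace Summit.ABC.IUTFork.Cor312Vol.RamifiedEWitness

open Set Thm311 Cor312 Cor312.Checks Cor312.IdentifiedNonVacuity NaiveWitness PinnedWitness Literature.IUT.LogThetaLattice
open RamifiedWitness (PLe IsPInt ple_zero isPInt_one fib eq_fib ple_ppow_iff)
open Repair.CandMochizuki7RamE (piEltE piEltE_mem_box_iff)

variable (p e : ℕ)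

/-! ## 1. `π`-adic valuation bounds scaled by `e`: `VLe k c` ⟺ `c = 0 ∨ e·v_p(c) ≥ k` -/

/-- `VLe k c`: the rational number `c`, viewed in `K = ℚ_p(p^{1/e})`, has `π`-adic valuation `e·v_p(c) ≥ k` (or is `0`). Bookkeeping predicate
with parameters (not a fact). [folklore] -/
def VLe (k : ℤ) (c : ℚ) : Prop := c = 0 ∨ k ≤ (e : ℤ) * padicValRat p c

variable {p e}

/-- `VLe k 0`. [folklore] -/
theorem vle_zero (k : ℤ) : VLe p e k 0 := Or.inl rfl
/-- Monotonicity in the bound. [folklore] -/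
theorem VLe.mono {k k' : ℤ} {c : ℚ} (h : VLe p e k c) (hk : k' ≤ k) : VLe p e k' c := h.imp id fun h' => hk.trans h'

/-- `VLe 0 1`. [folklore] -/
theorem vle_zero_one : VLe p e 0 1 := Or.inr (by rw [padicValRat.one, mul_zero])
/-- Membership in a polydisc, restated: `x ∈ box k ⟺ ∀ ε, VLe (k − wt ε) (x_ε)`. [folklore] -/
theorem mem_box_iff_vle {j : toyIndex.Label} {vQ : toyIndex.VQ} (k : ℤ) (x : (ramShellsE p e).Packet j vQ) :
    x ∈ box p e j vQ k ↔ ∀ ε, VLe p e (k - wt e ε) (coord p e j vQ x ε) := by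
  exact forall_congr' fun ε => or_congr Iff.rfl (by omega)

section WithPrime

variable [hp : Fact p.Prime]

/-- `VLe k` is closed under addition (ultrametric inequality). [folklore] -/
theorem VLe.add {k : ℤ} {c d : ℚ} (hc : VLe p e k c) (hd : VLe p e k d) : VLe p e k (c + d) := by
  rcases eq_or_ne c 0 with rfl | hc0
  · rwa [zero_add]
  rcases eq_or_ne d 0 with rfl | hd0
  · rwa [add_zero]
  rcases eq_or_ne (c + d) 0 with h0 | h0
  · exact Or.inl h0
  have hc' : k ≤ (e : ℤ) * padicValRat p c := hc.resolve_left hc0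
  have hd' : k ≤ (e : ℤ) * padicValRat p d := hd.resolve_left hd0
  have hmin := padicValRat.min_le_padicValRat_add (p := p) h0
  have he : (0 : ℤ) ≤ e := by positivity
  rcases min_le_iff.1 hmin with h | h
  · exact Or.inr (hc'.trans (mul_le_mul_of_nonneg_left h he))
  · exact Or.inr (hd'.trans (mul_le_mul_of_nonneg_left h he))

/-- `VLe` is additive in the bound under multiplication. [folklore] -/
theorem VLe.mul {k k' : ℤ} {c d : ℚ} (hc : VLe p e k c) (hd : VLe p e k' d) : VLe p e (k + k') (c * d) := by
  rcases eq_or_ne c 0 with rfl | hc0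
  · exact Or.inl (zero_mul d)
  rcases eq_or_ne d 0 with rfl | hd0
  · exact Or.inl (mul_zero c)
  right
  rw [padicValRat.mul hc0 hd0, mul_add]
  exact add_le_add (hc.resolve_left hc0) (hd.resolve_left hd0)

/-- Finite sums. [folklore] -/
theorem vle_sum {k : ℤ} {ι : Type} (s : Finset ι) (f : ι → ℚ) (h : ∀ i ∈ s, VLe p e k (f i)) : VLe p e k (∑ i ∈ s, f i) := by
  classical
  induction s using Finset.induction_on with
  | empty => rw [Finset.sum_empty]; exact vle_zero k
  | insert a s ha ih =>
    rw [Finset.sum_insert ha]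
    exact (h a (Finset.mem_insert_self a s)).add (ih fun i hi => h i (Finset.mem_insert_of_mem hi))

/-- Finite products: the bounds add up. [folklore] -/
theorem vle_prod {ι : Type} [DecidableEq ι] (s : Finset ι) (d : ι → ℤ) (f : ι → ℚ) (h : ∀ i ∈ s, VLe p e (d i) (f i)) :
    VLe p e (∑ i ∈ s, d i) (∏ i ∈ s, f i) := by
  induction s using Finset.induction_on with
  | empty => rw [Finset.sum_empty, Finset.prod_empty]; exact vle_zero_one
  | insert a s ha ih =>
    rw [Finset.sum_insert ha, Finset.prod_insert ha]
    exact (h a (Finset.mem_insert_self a s)).mul (ih fun i hi => h i (Finset.mem_insert_of_mem hi))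

end WithPrime

/-! ## 2. The valuation lattices `π^k𝒪_K` and the valuation-isometries `isoKE` -/

variable (p e)

/-- **`latE k` = `π^k·𝒪_K` in the basis `(π^a)_{a<e}`**: `x = Σ x_a π^a` with `e·v_p(x_a) + a ≥ k` for every nonzero coordinate. [folklore] -/
def latE (k : ℤ) : Set (Fin e → ℚ) := {x | ∀ a : Fin e, VLe p e (k - ((a : ℕ) : ℤ)) (x a)}

/-- **`isoKE`: the VALUATION-ISOMETRIES of `K = ℚ_p(π)`** — the `ℚ`-linear automorphisms preserving EVERY `π^k𝒪_K` (`x ∈ π^k𝒪_K ⟺ g x ∈ π^k𝒪_K`):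
the most generous ISOMETRIC reading of print's Ism on the ramified shell of index `e` (⊇ `𝒪_K^×`-multiplications, Galois conjugation; ⊉ the basis
transpositions / reversal / transvections of `GL(I)`). [claim: Mochizuki2012, status: disputed] -/
def isoKE : Set ((Fin e → ℚ) ≃ₗ[ℚ] (Fin e → ℚ)) := {g | ∀ (k : ℤ) (x : Fin e → ℚ), x ∈ latE p e k ↔ g x ∈ latE p e k}

/-- The identity is a valuation-isometry. [folklore] -/
theorem refl_mem_isoKE : LinearEquiv.refl ℚ (Fin e → ℚ) ∈ isoKE p e := fun _ _ => Iff.rfl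

variable {p e}
/-- Valuation-isometries are closed under inversion. [folklore] -/
theorem symm_mem_isoKE {g : (Fin e → ℚ) ≃ₗ[ℚ] (Fin e → ℚ)} (hg : g ∈ isoKE p e) : g.symm ∈ isoKE p e := fun k x => by
  rw [hg k (g.symm x), LinearEquiv.apply_symm_apply]

/-- `𝒪_K = π^0𝒪_K` is the lattice `I`: `x ∈ latE 0 ⟺ x` is integral (for `0 ≤ a < e`, `e·v + a ≥ 0 ⟺ v ≥ 0`). [folklore] -/
theorem mem_latE_zero_iff (x : Fin e → ℚ) : x ∈ latE p e 0 ↔ IntVec p e x := by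
  show (∀ a : Fin e, VLe p e (0 - ((a : ℕ) : ℤ)) (x a)) ↔ ∀ a : Fin e, IsPInt p (x a)
  refine forall_congr' fun a => or_congr Iff.rfl ?_
  have ha : ((a : ℕ) : ℤ) < e := by exact_mod_cast a.isLt
  refine ⟨fun h => ?_, fun h => ?_⟩
  · by_contra hv
    have h1 : (e : ℤ) * padicValRat p (x a) ≤ (e : ℤ) * (-1) := mul_le_mul_of_nonneg_left (by omega) (by positivity)
    omega
  · have h1 : (e : ℤ) * 0 ≤ (e : ℤ) * padicValRat p (x a) := mul_le_mul_of_nonneg_left h (by positivity)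
    omega

variable (p e) in
/-- **Valuation-isometries are lattice automorphisms** (`isoKE ⊆ GL(I)`): every isometric reading is a reading inside RAM_e's Ism. [folklore] -/
theorem isoKE_subset_latticeAuts : isoKE p e ⊆ latticeAuts p e := fun g hg x => by
  rw [← mem_latE_zero_iff, ← mem_latE_zero_iff]; exact hg 0 x

/-- `π^b ∈ π^b𝒪_K`. [folklore] -/
theorem single_mem_latE (b : Fin e) : (Pi.single b (1 : ℚ) : Fin e → ℚ) ∈ latE p e b := fun a => by
  by_cases h : a = b
  · subst h; rw [Pi.single_eq_same]; exact vle_zero_one.mono (by omega)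
  · rw [Pi.single_eq_of_ne h]; exact vle_zero _

/-- **The matrix of a valuation-isometry is lower-triangular by valuation: `e·v_p(g_{ab}) ≥ b − a`** (`g(π^b) ∈ π^b𝒪_K`). [folklore] -/
theorem vle_ent_isoKE {g : (Fin e → ℚ) ≃ₗ[ℚ] (Fin e → ℚ)} (hg : g ∈ isoKE p e) (a b : Fin e) :
    VLe p e (((b : ℕ) : ℤ) - (a : ℕ)) (ent e g a b) :=
  ((hg b _).1 (single_mem_latE b)) a

/-! ## 3. Valuation-monotone maps preserve every polydisc; the (Ind1),(Ind2)-group of an isometric reading -/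

/-- A linear self-map of a packet is VALUATION-MONOTONE: the `ε`-coordinate of `f(e_{ε'})` has `e·v_p ≥ wt ε' − wt ε`. Bookkeeping predicate. [folklore] -/
def ValMonoE (j : toyIndex.Label) (vQ : toyIndex.VQ) (f : (ramShellsE p e).Packet j vQ →ₗ[ℚ] (ramShellsE p e).Packet j vQ) : Prop :=
  ∀ ε' ε, VLe p e ((wt e ε' : ℤ) - wt e ε) (coord p e j vQ (f (tb p e j vQ ε')) ε)

/-- **A permutation of the tensor factors is valuation-monotone** (it permutes the monomials, preserving weights). [folklore] -/
theorem valMonoE_permute (j : toyIndex.Label) (vQ : toyIndex.VQ) (σ : Equiv.Perm (toyIndex.Caps j)) :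
    ValMonoE j vQ ((ramShellsE p e).permute j vQ σ).toLinearMap := fun ε' ε => by
  rw [LinearEquiv.coe_coe, tb_apply]
  unfold LogShells.permute
  erw [PiTensorProduct.reindex_tprod]
  rw [← tb_apply, coord_tb]
  split_ifs with h
  · have hw : wt e (fun i => ε' (σ.symm i)) = wt e ε' := Equiv.sum_comp σ.symm (fun i => ((ε' i : Fin e) : ℕ))
    rw [← h, hw]
    exact vle_zero_one.mono (by omega)
  · exact vle_zero _

/-- **Matrix of a factorwise family in the tensor basis** (Kronecker product): `(⊗_i g_i)(e_{ε'})_ε = Π_i (g_i)_{ε(i) ε'(i)}`. [folklore] -/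
theorem coord_factorwise_tb (j : toyIndex.Label) (vQ : toyIndex.VQ)
    (g : toyIndex.Caps j → toyIndex.Fibre vQ → ((Fin e → ℚ) ≃ₗ[ℚ] (Fin e → ℚ))) (ε ε' : toyIndex.Caps j → Fin e) :
    coord p e j vQ (((ramShellsE p e).factorwise j vQ fun i => (ramShellsE p e).summandwise vQ (g i)) (tb p e j vQ ε')) ε =
      ∏ i, ent e (g i (fib vQ)) (ε i) (ε' i) := by
  rw [tb_apply]
  unfold LogShells.factorwise
  erw [PiTensorProduct.congr_tprod, coord_tprod]
  refine Finset.prod_congr rfl fun i _ => ?_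
  have h : ((ramShellsE p e).summandwise vQ (g i) (b1 p e vQ (ε' i))) (fib vQ) = g i (fib vQ) (Pi.single (ε' i) 1) := by
    show g i (fib vQ) (b1 p e vQ (ε' i) (fib vQ)) = _
    rw [b1_apply]
  rw [h]
  rfl

/-- A packet-automorphism family PRESERVES THE POLYDISCS if it and its inverse map every `box k` into itself. Bookkeeping predicate. [folklore] -/
structure PreservesBoxesE (Φ : (ramShellsE p e).PacketAut) : Prop where
  /-- `Φ` maps boxes into boxes -/
  fwd : ∀ (j : toyIndex.Label) (vQ : toyIndex.VQ) (k : ℤ) (x : (ramShellsE p e).Packet j vQ), x ∈ box p e j vQ k → Φ j vQ x ∈ box p e j vQ k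
  /-- `Φ⁻¹` maps boxes into boxes -/
  bwd : ∀ (j : toyIndex.Label) (vQ : toyIndex.VQ) (k : ℤ) (x : (ramShellsE p e).Packet j vQ), x ∈ box p e j vQ k → Φ⁻¹ j vQ x ∈ box p e j vQ k

/-- The identity preserves the polydiscs. [folklore] -/
theorem preservesBoxesE_one : PreservesBoxesE (p := p) (e := e) 1 :=
  ⟨fun _ _ _ _ hx => hx, fun _ _ _ _ hx => by rw [inv_one]; exact hx⟩
/-- Closed under products. [folklore] -/
theorem PreservesBoxesE.mul {Φ Ψ : (ramShellsE p e).PacketAut} (hΦ : PreservesBoxesE Φ) (hΨ : PreservesBoxesE Ψ) :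
    PreservesBoxesE (Φ * Ψ) :=
  ⟨fun j vQ k x hx => hΦ.fwd j vQ k _ (hΨ.fwd j vQ k x hx), fun j vQ k x hx => by
    rw [mul_inv_rev]; exact hΨ.bwd j vQ k _ (hΦ.bwd j vQ k x hx)⟩
/-- Closed under inverses. [folklore] -/
theorem PreservesBoxesE.inv' {Φ : (ramShellsE p e).PacketAut} (hΦ : PreservesBoxesE Φ) : PreservesBoxesE Φ⁻¹ :=
  ⟨hΦ.bwd, fun j vQ k x hx => by rw [inv_inv]; exact hΦ.fwd j vQ k x hx⟩

/-- A box-preserving family maps every box ONTO itself. [folklore] -/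
theorem PreservesBoxesE.image_eq {Φ : (ramShellsE p e).PacketAut} (hP : PreservesBoxesE Φ) (j : toyIndex.Label) (vQ : toyIndex.VQ) (k : ℤ) :
    Φ j vQ '' box p e j vQ k = box p e j vQ k := by
  refine Set.Subset.antisymm (by rintro _ ⟨x, hx, rfl⟩; exact hP.fwd j vQ k x hx) fun y hy => ?_
  exact ⟨(Φ j vQ).symm y, hP.bwd j vQ k y hy, (Φ j vQ).apply_symm_apply y⟩

/-- A box-preserving family preserves membership in every box. [folklore] -/
theorem PreservesBoxesE.mem_iff {Φ : (ramShellsE p e).PacketAut} (hP : PreservesBoxesE Φ) (j : toyIndex.Label) (vQ : toyIndex.VQ) (k : ℤ)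
    (x : (ramShellsE p e).Packet j vQ) : Φ j vQ x ∈ box p e j vQ k ↔ x ∈ box p e j vQ k := by
  refine ⟨fun h => ?_, hP.fwd j vQ k x⟩
  have h' := hP.bwd j vQ k _ h
  rwa [Pi.inv_apply, Pi.inv_apply, LinearEquiv.coe_inv, LinearEquiv.symm_apply_apply] at h'

section WithPrime

variable [hp : Fact p.Prime]

/-- **A valuation-monotone map sends `box k` into `box k`.** [folklore] -/
theorem box_map_of_valMonoE {j : toyIndex.Label} {vQ : toyIndex.VQ}
    {f : (ramShellsE p e).Packet j vQ →ₗ[ℚ] (ramShellsE p e).Packet j vQ} (hf : ValMonoE j vQ f) {k : ℤ} {x : (ramShellsE p e).Packet j vQ}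
    (hx : x ∈ box p e j vQ k) : f x ∈ box p e j vQ k := by
  rw [mem_box_iff_vle] at hx ⊢
  intro ε
  rw [coord_map_eq_sum]
  refine vle_sum _ _ fun ε' _ => ?_
  exact ((hx ε').mul (hf ε' ε)).mono (by omega)

/-- **A factorwise valuation-isometry is valuation-monotone** (Kronecker formula + `e·v_p(g_{ab}) ≥ b − a` factor by factor). [folklore] -/
theorem valMonoE_factorwise {j : toyIndex.Label} {vQ : toyIndex.VQ}
    (g : toyIndex.Caps j → ∀ v : toyIndex.Fibre vQ, (Fin e → ℚ) ≃ₗ[ℚ] (Fin e → ℚ)) (hg : ∀ i v, g i v ∈ isoKE p e) :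
    ValMonoE j vQ ((ramShellsE p e).factorwise j vQ fun i => (ramShellsE p e).summandwise vQ (g i)).toLinearMap := fun ε' ε => by
  classical
  rw [LinearEquiv.coe_coe, coord_factorwise_tb]
  have hprod := vle_prod (p := p) (e := e) Finset.univ (fun i => (((ε' i : Fin e) : ℕ) : ℤ) - ((ε i : Fin e) : ℕ))
    (fun i => ent e (g i (fib vQ)) (ε i) (ε' i)) fun i _ => vle_ent_isoKE (hg i (fib vQ)) (ε i) (ε' i)
  refine hprod.mono (le_of_eq ?_)
  unfold wt
  push_cast
  rw [Finset.sum_sub_distrib]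

section Iso

variable {G₁ G₂ : Set ((Fin e → ℚ) ≃ₗ[ℚ] (Fin e → ℚ))} {h₁ : LinearEquiv.refl ℚ (Fin e → ℚ) ∈ G₁} {h₂ : LinearEquiv.refl ℚ (Fin e → ℚ) ∈ G₂}

/-- (Ind2)-families of an isometric reading preserve the polydiscs. [folklore] -/
theorem preservesBoxesE_of_mem_Ind2FamilyWith (hG₂ : G₂ ⊆ isoKE p e) {Φ : (ramShellsE p e).PacketAut}
    (h : Φ ∈ (ramShellsWith p e G₁ G₂ h₁ h₂).Ind2Family) : PreservesBoxesE Φ := by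
  refine ⟨fun j vQ k x hx => ?_, fun j vQ k x hx => ?_⟩
  · obtain ⟨g, hg, hΦ⟩ := h j vQ
    rw [hΦ]
    exact box_map_of_valMonoE (valMonoE_factorwise g fun i v => hG₂ (hg i v)) hx
  · obtain ⟨g, hg, hΦ⟩ := h j vQ
    have hΦ' : Φ j vQ = (ramShellsE p e).factorwise j vQ fun i => (ramShellsE p e).summandwise vQ (g i) := hΦ
    rw [Pi.inv_apply, Pi.inv_apply, hΦ', factorwise_summandwise_inv]
    exact box_map_of_valMonoE (valMonoE_factorwise _ fun i v => symm_mem_isoKE (hG₂ (hg i v))) hx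

/-- (Ind1)-families of an isometric reading preserve the polydiscs. [folklore] -/
theorem preservesBoxesE_of_mem_Ind1FamilyWith (hG₁ : G₁ ⊆ isoKE p e) {Φ : (ramShellsE p e).PacketAut}
    (h : Φ ∈ (ramShellsWith p e G₁ G₂ h₁ h₂).Ind1Family) : PreservesBoxesE Φ := by
  refine ⟨fun j vQ k x hx => ?_, fun j vQ k x hx => ?_⟩
  · obtain ⟨σ, hh, hmem, hΦ⟩ := h j
    have hΦ' : Φ j vQ = ((ramShellsE p e).permute j vQ σ).trans
        ((ramShellsE p e).factorwise j vQ fun i => (ramShellsE p e).summandwise vQ fun v => hh i v.1) := hΦ vQ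
    rw [hΦ', LinearEquiv.trans_apply]
    exact box_map_of_valMonoE (valMonoE_factorwise (fun i v => hh i v.1) fun i v => hG₁ (hmem i v.1))
      (box_map_of_valMonoE (valMonoE_permute j vQ σ) hx)
  · obtain ⟨σ, hh, hmem, hΦ⟩ := h j
    have hΦ' : Φ j vQ = ((ramShellsE p e).factorwise j vQ fun i => (ramShellsE p e).summandwise vQ fun v => hh i v.1) *
        (ramShellsE p e).permute j vQ σ := by
      rw [LinearEquiv.mul_eq_trans]; exact hΦ vQ
    rw [Pi.inv_apply, Pi.inv_apply, hΦ', mul_inv_rev, factorwise_summandwise_inv, ← LogShells.permute_inv, LinearEquiv.mul_apply]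
    exact box_map_of_valMonoE (valMonoE_permute j vQ σ⁻¹)
      (box_map_of_valMonoE (valMonoE_factorwise _ fun i v => symm_mem_isoKE (hG₁ (hmem i v.1))) hx)

/-- **Every element of the (Ind1),(Ind2)-group of an isometric reading preserves the polydiscs.** [folklore] -/
theorem preservesBoxesE_of_mem_closureIso (hG₁ : G₁ ⊆ isoKE p e) (hG₂ : G₂ ⊆ isoKE p e) {Φ : (ramShellsE p e).PacketAut}
    (hΦ : Φ ∈ Subgroup.closure ((ramShellsWith p e G₁ G₂ h₁ h₂).Ind1Family ∪ (ramShellsWith p e G₁ G₂ h₁ h₂).Ind2Family)) :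
    PreservesBoxesE Φ := by
  induction hΦ using Subgroup.closure_induction with
  | mem Ψ hΨ =>
    rcases hΨ with h1 | h2
    · exact preservesBoxesE_of_mem_Ind1FamilyWith hG₁ h1
    · exact preservesBoxesE_of_mem_Ind2FamilyWith hG₂ h2
  | one => exact preservesBoxesE_one
  | mul Ψ Ψ' _ _ hΨ hΨ' => exact hΨ.mul hΨ'
  | inv Ψ _ hΨ => exact hΨ.inv'

/-- **VALUATION CLASSES ARE RIGID under an isometric reading**: an element of ⟨(Ind1)∪(Ind2)⟩ carries `π^k` to `π^{k'}` only if `k = k'`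
(`π^k ∈ box k ∖ box (k+1)`, and boxes are preserved both ways). [folklore] -/
theorem image_piEltE_eq_piEltE_imp [NeZero e] (hG₁ : G₁ ⊆ isoKE p e) (hG₂ : G₂ ⊆ isoKE p e) {Φ : (ramShellsE p e).PacketAut}
    (hΦ : Φ ∈ Subgroup.closure ((ramShellsWith p e G₁ G₂ h₁ h₂).Ind1Family ∪ (ramShellsWith p e G₁ G₂ h₁ h₂).Ind2Family))
    (j : toyIndex.Label) (vQ : toyIndex.VQ) {k k' : ℤ} (h : Φ j vQ (piEltE p e j vQ k) = piEltE p e j vQ k') : k = k' := by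
  have hP := preservesBoxesE_of_mem_closureIso hG₁ hG₂ hΦ
  have h1 : piEltE p e j vQ k' ∈ box p e j vQ k := by
    rw [← h, hP.mem_iff, piEltE_mem_box_iff]
  have h2 : piEltE p e j vQ k' ∉ box p e j vQ (k + 1) := by
    rw [← h, hP.mem_iff, piEltE_mem_box_iff]; omega
  rw [piEltE_mem_box_iff] at h1 h2
  omega

/-! ## 4. Isometric readings: (Ind1),(Ind2) ELIMINABLE; typed Corollary and licence FALSE at every depth `m ≥ 1` -/

variable (p e) (h₁ h₂) [NeZero e] (m : ℕ)

/-- **Under an isometric reading the possible images are the Θ-box alone, so `ⁿ˒°𝒰_j = box(m·j²)`: (Ind1),(Ind2) are ELIMINABLE** (every index `e`).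
[claim: Mochizuki2012, status: disputed] -/
theorem thetaHullWith_eq_thetaBox_of_isometricE (hG₁ : G₁ ⊆ isoKE p e) (hG₂ : G₂ ⊆ isoKE p e) (j : toyIndex.Label) (vQ : toyIndex.VQ) :
    (ramSettingWith p e G₁ G₂ h₁ h₂ m).thetaHull j vQ = box p e j vQ ((m : ℤ) * jsq j) := by
  have hU : (⋃₀ (ramSettingWith p e G₁ G₂ h₁ h₂ m).possibleImages j vQ : Set ((ramSituationWith p e G₁ G₂ h₁ h₂).L.Packet j vQ)) =
      box p e j vQ ((m : ℤ) * jsq j) := by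
    apply Set.Subset.antisymm
    · rintro x ⟨U, ⟨Φ, hΦ, rfl⟩, hx⟩
      rw [ramSettingWith_thetaRegion3] at hx
      have himg : Φ j vQ '' box p e j vQ ((m : ℤ) * jsq j) = box p e j vQ ((m : ℤ) * jsq j) :=
        (preservesBoxesE_of_mem_closureIso hG₁ hG₂ hΦ).image_eq j vQ _
      rw [himg] at hx
      exact hx
    · exact thetaBox_subset_sUnion_possibleImagesWith p e h₁ h₂ m j vQ
  exact (congrArg (rFrame p e j vQ).hull hU).trans (rFrame_hull_box j vQ _)

/-- The local Θ-term under an isometric reading: `μ(box(m·j²)) = −(m·j²/e)·log p` (no inflation). [folklore] -/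
theorem thetaLocalWith_isometricE (hG₁ : G₁ ⊆ isoKE p e) (hG₂ : G₂ ⊆ isoKE p e) (j : toyIndex.Label) (vQ : toyIndex.VQ) :
    (ramSettingWith p e G₁ G₂ h₁ h₂ m).thetaLocal j vQ = ((-((((m : ℤ) * jsq j : ℤ) : ℝ) / e) * Real.log p : ℝ) : WithTop ℝ) := by
  unfold Setting.thetaLocal
  rw [if_pos (ramSettingWith_hullDefined p e h₁ h₂ m (hG₁.trans (isoKE_subset_latticeAuts p e))
    (hG₂.trans (isoKE_subset_latticeAuts p e)) j vQ)]
  show ((rVol p e j vQ ((rFrame p e j vQ).hull ((ramSettingWith p e G₁ G₂ h₁ h₂ m).thetaHull j vQ)) : ℝ) : WithTop ℝ) = _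
  rw [thetaHullWith_eq_thetaBox_of_isometricE p e h₁ h₂ m hG₁ hG₂, rFrame_hull_box, rVol_box]

/-- **`−|log(Θ)| = −(5m/(2e))·log p` under every isometric reading** (= the Θ-pilot's own volume: no gain). [claim: Mochizuki2012, status: disputed] -/
theorem negLogThetaWith_isometricE (hG₁ : G₁ ⊆ isoKE p e) (hG₂ : G₂ ⊆ isoKE p e) :
    (ramSettingWith p e G₁ G₂ h₁ h₂ m).negLogTheta = ((-((5 : ℝ) * m / (2 * e)) * Real.log p : ℝ) : WithTop ℝ) := by
  unfold Setting.negLogTheta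
  rw [if_pos (ramSettingWith_thetaFinite p e h₁ h₂ m (hG₁.trans (isoKE_subset_latticeAuts p e)) (hG₂.trans (isoKE_subset_latticeAuts p e)))]
  have h : (fun i : Fin toyIndex.lstar =>
      ∑ᶠ vQ : toyIndex.VQ, ((ramSettingWith p e G₁ G₂ h₁ h₂ m).thetaLocal (Setting.labelSucc i) vQ).untopD 0) =
      fun i => -((((m : ℤ) * jsq (Setting.labelSucc i) : ℤ) : ℝ) / e) * Real.log p := by
    funext i
    rw [finsum_unique, thetaLocalWith_isometricE p e h₁ h₂ m hG₁ hG₂, WithTop.untopD_coe]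
  rw [h]
  congr 1
  unfold processionNormalized
  show (∑ i : Fin 2, -((((m : ℤ) * jsq (Setting.labelSucc i) : ℤ) : ℝ) / e) * Real.log p) / ((2 : ℕ) : ℝ) = _
  have h0 : jsq (Setting.labelSucc ((0 : Fin 2) : Fin toyIndex.lstar) : toyIndex.Label) = 1 := rfl
  have h1 : jsq (Setting.labelSucc ((1 : Fin 2) : Fin toyIndex.lstar) : toyIndex.Label) = 4 := rfl
  rw [Fin.sum_univ_two, h0, h1]
  have he : (e : ℝ) ≠ 0 := Nat.cast_ne_zero.mpr (NeZero.ne e)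
  push_cast
  field_simp
  ring

/-- **UNDER EVERY ISOMETRIC READING THE TYPED COROLLARY FAILS AT EVERY DEPTH `m ≥ 1` AND EVERY INDEX `e`**
(`−(5m/(2e))·log p < −(m/e)·log p`). [claim: Mochizuki2012, status: disputed] -/
theorem not_statementWith_of_isometricE (hG₁ : G₁ ⊆ isoKE p e) (hG₂ : G₂ ⊆ isoKE p e) (hm : 1 ≤ m) :
    ¬ (ramSettingWith p e G₁ G₂ h₁ h₂ m).Statement := by
  rintro ⟨-, h⟩
  rw [ramSettingWith_negLogQ, negLogThetaWith_isometricE p e h₁ h₂ m hG₁ hG₂, WithTop.coe_le_coe] at h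
  have hL := log_p_pos p
  have he : (0 : ℝ) < e := by exact_mod_cast Nat.pos_of_ne_zero (NeZero.ne e)
  have hm' : (1 : ℝ) ≤ m := by exact_mod_cast hm
  have h2 : (5 : ℝ) * m / (2 * e) * Real.log p ≤ (m : ℝ) / e * Real.log p := by linarith
  have h3 := le_of_mul_le_mul_right h2 hL
  rw [div_le_div_iff₀ (by positivity) he] at h3
  have hme : (0 : ℝ) < (m : ℝ) * e := mul_pos (by linarith) he
  nlinarith [h3, hme]

/-- **UNDER EVERY ISOMETRIC READING THE HULL INCLUSION (licence, (xi-f)) FAILS** (`m ≥ 1`; label 2: `box m ⊄ box 4m = ⁿ˒°𝒰₂`).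
[claim: Mochizuki2012, status: disputed] -/
theorem not_licenceWith_of_isometricE (hG₁ : G₁ ⊆ isoKE p e) (hG₂ : G₂ ⊆ isoKE p e) (hm : 1 ≤ m) :
    ¬ Thm311ToCor312.Licence (ramSettingWith p e G₁ G₂ h₁ h₂ m) := fun hl => by
  have h2 := hl ((1 : Fin 2) : Fin toyIndex.lstar) ()
  rw [ramSettingWith_qRegion_of_ne_zero p e G₁ G₂ h₁ h₂ m (Setting.labelSucc_ne_zero _),
    thetaHullWith_eq_thetaBox_of_isometricE p e h₁ h₂ m hG₁ hG₂] at h2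
  have h3 := (box_subset_iff (p := p) (e := e) _ _ _ _).1 h2
  have hj : jsq (Setting.labelSucc ((1 : Fin 2) : Fin toyIndex.lstar) : toyIndex.Label) = 4 := rfl
  rw [hj] at h3
  have hm' : (1 : ℤ) ≤ m := by exact_mod_cast hm
  omega

end Iso

end WithPrime

end Summit.ABC.IUTFork.Cor312Vol.RamifiedEWitness

end
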